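import Summits.RiemannHypothesis.RiemannHypothesis.Theorems.SemilocalDeletionGeneralFloor
import Summits.RiemannHypothesis.RiemannHypothesis.Theorems.SemilocalDeletionToeplitzFloor
import Summits.RiemannHypothesis.RiemannHypothesis.Theorems.SemilocalDeletionDipole
import HarnessLib

/-!
# General COMBS: the deletion perturbation of a separated comb IS the configuration (animal) form — sharpness of the lattice floor

Companion of `SemilocalDeletionAnimalFloor` (the FLOOR: a lattice/animal certificate with constant `μ` gives
`Re Q_{S'}(g) ≥ Re Q_S(g) − μ‖g‖₂²` on `C(c)`).  This file is the other direction, at the level of the perturbation form, for an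
ARBITRARY finite configuration of positions `x_i ∈ ℝ` (`i ∈ s`) — not only the arithmetic progressions of `…ToeplitzCombs` or the
rectangles of `…PairCombs`.  For a block `h ∈ C(δ)` and amplitudes `a_i ∈ ℂ` put `g(t) = Σ_{i∈s} a_i·h(t − x_i)`.  Then

* §1 `g` is a Weil test function supported in `[−c, c]` when all `x_i ∈ [−(c−δ), c−δ]`; its autocorrelation is
  `k_g(L) = Σ_{i,j} a_i conj(a_j)·k_h(L + x_j − x_i)` (`weilConv_weilReflect_comb`), `k = · ⋆ ·̃`;
* §2 **EXACT PERTURBATION IDENTITY** (`weilSemilocalQuadratic_sub_comb`): if the configuration is SEPARATED with respect to the moved atoms —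
  for all `i, j ∈ s` and every `n ≤ N` with `w_n = Λ_S(n)n^{-1/2} − Λ_{S'}(n)n^{-1/2} ≠ 0`, either `x_i − x_j = log n` exactly or
  `|x_i − x_j − log n| > 2δ` — then for ANY finite `S, S'` and `2c < log (N+1)`:
  `Q_{S'}(g) − Q_S(g) = ‖h‖₂² · Σ_{n ≤ N} w_n Σ_{i,j : x_i − x_j = log n} (a_i conj a_j + a_j conj a_i)`,
  i.e. the perturbation form evaluated on the comb is EXACTLY `‖h‖₂²` times the configuration (lag-matrix) form of the amplitudes;
* §3 `integral_norm_sq_comb`: `‖g‖₂² = ‖h‖₂²·Σ_i |a_i|²` for pairwise `2δ`-separated positions, and the Rayleigh consequence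
  `semilocalGroundEnergy_mul_le_comb`: `λ_min(S'; c)·‖h‖₂² Σ|a_i|² ≤ Re Q_S(g) + ‖h‖₂²·(configuration form)`.

So for every finite animal `F` of the slab (positions `u + Σ k_p log p` pairwise separated and separated from the lags, which holds for
narrow enough blocks since the positions are distinct reals) the lattice constant `−λ_min(A_F)` is ATTAINED by combs up to the undeleted
energy `Re Q_S(g)` of the comb: the best constant of the animal certificate is the exact joint lag floor (cc-s2-1 gen16/17, STAIRCASE-Z §3,
ANIMAL-SUPREMUM.md).  Nothing here bears on RH; these are statements about truncated Weil forms.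
-/

set_option linter.dupNamespace false

noncomputable section

open Complex Filter Set MeasureTheory
open scoped Real Topology ComplexConjugate

namespace Summit.RiemannHypothesis.RiemannHypothesis.Theorems.SemilocalDeletionAnimalCombs

open Literature.NumberTheory.LFunctions
open Summit.RiemannHypothesis.RiemannHypothesis.Theorems.SemilocalDeletionGeneralFloor
open Summit.RiemannHypothesis.RiemannHypothesis.Theorems.SemilocalDeletionToeplitzFloor
open Summit.RiemannHypothesis.RiemannHypothesis.Theorems.SemilocalDeletionDipole
open Summit.RiemannHypothesis.RiemannHypothesis.Theorems.HandoffSemilocalEnergy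

variable {β : Type*} {h : ℝ → ℂ} {δ c : ℝ} {s : Finset β} {x : β → ℝ} {a : β → ℂ} {S S' : Finset ℕ} {N : ℕ}

/-! ## §1  Combs at arbitrary positions -/

/-- A comb `Σ_{i∈s} a_i h(t − x_i)` of a Weil test function is a Weil test function. -/
theorem isWeilTest_comb (hh : IsWeilTest h) (s : Finset β) (x : β → ℝ) (a : β → ℂ) :
    IsWeilTest fun t ↦ ∑ i ∈ s, a i * h (t - x i) := by
  classical
  induction s using Finset.induction_on with
  | empty =>
    have := hh.const_mul 0
    simpa using this
  | insert i s hi ih =>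
    have hu : IsWeilTest fun t ↦ a i * h (t - x i) := (hh.weilTranslate (x i)).const_mul (a i)
    have e : (fun t ↦ ∑ j ∈ insert i s, a j * h (t - x j)) =
        (fun t ↦ a i * h (t - x i)) + fun t ↦ ∑ j ∈ s, a j * h (t - x j) := by
      funext t; rw [Finset.sum_insert hi, Pi.add_apply]
    rw [e]
    exact hu.add ih

/-- Support of the comb: if `tsupport h ⊆ [−δ, δ]` and every `x_i ∈ [−(c−δ), c−δ]` then the comb is supported in `[−c, c]`. -/
theorem tsupport_comb_subset (hsupp : tsupport h ⊆ Icc (-δ) δ) (hx : ∀ i ∈ s, x i ∈ Icc (-(c - δ)) (c - δ)) :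
    tsupport (fun t ↦ ∑ i ∈ s, a i * h (t - x i)) ⊆ Icc (-c) c := by
  refine (isClosed_Icc.closure_subset_iff).2 fun t ht ↦ ?_
  rw [Function.mem_support] at ht
  obtain ⟨i, hi, hne⟩ := Finset.exists_ne_zero_of_sum_ne_zero ht
  have hh0 : h (t - x i) ≠ 0 := fun h0 ↦ hne (by rw [h0, mul_zero])
  have h1 := hsupp (subset_tsupport _ (Function.mem_support.2 hh0))
  have h2 := hx i hi
  rw [mem_Icc] at h1 h2 ⊢
  constructor <;> linarith [h1.1, h1.2, h2.1, h2.2]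

/-- One pair of teeth: `∫ h(u − x) conj h(u − L − y) du = k_h(L + y − x)`. -/
theorem integral_tooth_mul_conj_tooth (h : ℝ → ℂ) (xi yj L : ℝ) :
    ∫ u : ℝ, h (u - xi) * conj (h (u - L - yj)) = weilConv h (weilReflect h) (L + yj - xi) := by
  rw [weilConv_weilReflect_apply']
  have := integral_sub_right_eq_self (μ := volume) (fun v : ℝ ↦ h v * conj (h (v - (L + yj - xi)))) xi
  rw [← this]
  refine integral_congr_ae (Eventually.of_forall fun u ↦ ?_)
  simp only
  ring_nf

/-- **Autocorrelation of a comb**: `k_g(L) = Σ_{i,j∈s} a_i conj(a_j) k_h(L + x_j − x_i)` for `g = Σ a_i h(· − x_i)`. -/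
theorem weilConv_weilReflect_comb (hh : IsWeilTest h) (s : Finset β) (x : β → ℝ) (a : β → ℂ) (L : ℝ) :
    weilConv (fun t ↦ ∑ i ∈ s, a i * h (t - x i)) (weilReflect fun t ↦ ∑ i ∈ s, a i * h (t - x i)) L =
      ∑ i ∈ s, ∑ j ∈ s, a i * conj (a j) * weilConv h (weilReflect h) (L + x j - x i) := by
  rw [weilConv_weilReflect_apply']
  have hint : ∀ i j, Integrable fun u : ℝ ↦ a i * conj (a j) * (h (u - x i) * conj (h (u - L - x j))) := by
    intro i j
    have := integrable_shift_mul_conj_shift hh (-x i) (-L - x j)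
    refine (this.congr (Eventually.of_forall fun u ↦ ?_)).const_mul _
    simp only [sub_eq_add_neg, add_assoc]
  have e : ∀ u : ℝ, (∑ i ∈ s, a i * h (u - x i)) * conj (∑ j ∈ s, a j * h (u - L - x j)) =
      ∑ i ∈ s, ∑ j ∈ s, a i * conj (a j) * (h (u - x i) * conj (h (u - L - x j))) := by
    intro u
    rw [map_sum, Finset.sum_mul_sum]
    refine Finset.sum_congr rfl fun i _ ↦ Finset.sum_congr rfl fun j _ ↦ ?_
    rw [map_mul]; ring
  simp_rw [e]
  rw [integral_finsetSum _ fun i _ ↦ integrable_finsetSum _ fun j _ ↦ hint i j]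
  refine Finset.sum_congr rfl fun i _ ↦ ?_
  rw [integral_finsetSum _ fun j _ ↦ hint i j]
  refine Finset.sum_congr rfl fun j _ ↦ ?_
  rw [integral_const_mul, integral_tooth_mul_conj_tooth]

/-- The autocorrelation of a block `h ∈ C(δ)` vanishes off `[−2δ, 2δ]`. -/
theorem weilConv_weilReflect_eq_zero_of_lt (hh : IsWeilTest h) (hsupp : tsupport h ⊆ Icc (-δ) δ) {t : ℝ}
    (ht : 2 * δ < |t|) : weilConv h (weilReflect h) t = 0 := by
  refine apply_eq_zero_of_not_mem (tsupport_weilConv_weilReflect_subset (a := δ) hh.2 hsupp) fun hm ↦ ?_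
  rw [mem_Icc] at hm
  have : |t| ≤ 2 * δ := abs_le.2 ⟨hm.1, hm.2⟩
  linarith

/-! ## §2  The exact perturbation identity on a separated comb -/

/-- One lag on a separated comb: if for all `i, j ∈ s` either `x_i − x_j = L` or `|x_i − x_j − L| > 2δ`, then
`k_g(L) + k_g(−L) = ‖h‖₂² · Σ_{i,j : x_i − x_j = L} (a_i conj a_j + a_j conj a_i)`. -/
theorem weilConv_weilReflect_comb_add_neg (hh : IsWeilTest h) (hsupp : tsupport h ⊆ Icc (-δ) δ) {L : ℝ}
    (hsep : ∀ i ∈ s, ∀ j ∈ s, x i - x j = L ∨ 2 * δ < |x i - x j - L|) :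
    weilConv (fun t ↦ ∑ i ∈ s, a i * h (t - x i)) (weilReflect fun t ↦ ∑ i ∈ s, a i * h (t - x i)) L +
        weilConv (fun t ↦ ∑ i ∈ s, a i * h (t - x i)) (weilReflect fun t ↦ ∑ i ∈ s, a i * h (t - x i)) (-L) =
      ((∫ u : ℝ, ‖h u‖ ^ 2 : ℝ) : ℂ) *
        ∑ i ∈ s, ∑ j ∈ s, (if x i - x j = L then a i * conj (a j) + a j * conj (a i) else 0) := by
  classical
  rw [weilConv_weilReflect_comb hh, weilConv_weilReflect_comb hh]
  -- reindex the second double sum by swapping i and j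
  rw [Finset.sum_comm (s := s) (t := s) (f := fun i j ↦ a i * conj (a j) * weilConv h (weilReflect h) (-L + x j - x i)),
    ← Finset.sum_add_distrib, Finset.mul_sum]
  refine Finset.sum_congr rfl fun i hi ↦ ?_
  rw [← Finset.sum_add_distrib, Finset.mul_sum]
  refine Finset.sum_congr rfl fun j hj ↦ ?_
  have e1 : L + x j - x i = -(x i - x j - L) := by ring
  have e2 : -L + x i - x j = x i - x j - L := by ring
  rw [e1, e2]
  by_cases heq : x i - x j = L
  · have h0 : x i - x j - L = 0 := by linarith
    rw [h0, neg_zero, weilConv_weilReflect_apply_zero, if_pos heq]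
    ring
  · have hfar : 2 * δ < |x i - x j - L| := (hsep i hi j hj).resolve_left heq
    rw [weilConv_weilReflect_eq_zero_of_lt hh hsupp (t := -(x i - x j - L)) (by rwa [abs_neg]),
      weilConv_weilReflect_eq_zero_of_lt hh hsupp hfar, if_neg heq]
    ring

/-- **EXACT PERTURBATION IDENTITY ON A SEPARATED COMB.**  `S, S'` any finite sets, `2c < log (N+1)`, `h ∈ C(δ)` a Weil test function,
positions `x_i ∈ [−(c−δ), c−δ]` SEPARATED with respect to the moved atoms: for all `i, j ∈ s` and every `n ≤ N` with
`Λ_S(n)n^{-1/2} ≠ Λ_{S'}(n)n^{-1/2}`, `x_i − x_j = log n` or `|x_i − x_j − log n| > 2δ`.  Then for the comb `g = Σ_i a_i h(· − x_i)`: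
`Q_{S'}(g) − Q_S(g) = ‖h‖₂² · Σ_{n ≤ N} (Λ_S(n) − Λ_{S'}(n)) n^{-1/2} · Σ_{i,j : x_i − x_j = log n} (a_i conj a_j + a_j conj a_i)` —
the perturbation form of a comb IS the configuration (lag-matrix) form of its amplitudes. -/
theorem weilSemilocalQuadratic_sub_comb (hh : IsWeilTest h) (hsupp : tsupport h ⊆ Icc (-δ) δ)
    (hx : ∀ i ∈ s, x i ∈ Icc (-(c - δ)) (c - δ)) (hN : 2 * c < Real.log ((N : ℝ) + 1)) (S S' : Finset ℕ)
    (hsep : ∀ i ∈ s, ∀ j ∈ s, ∀ n ∈ Finset.range (N + 1), weilSemilocalCoeff S n - weilSemilocalCoeff S' n ≠ 0 →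
      x i - x j = Real.log n ∨ 2 * δ < |x i - x j - Real.log n|) :
    weilSemilocalQuadratic S' (fun t ↦ ∑ i ∈ s, a i * h (t - x i)) -
        weilSemilocalQuadratic S (fun t ↦ ∑ i ∈ s, a i * h (t - x i)) =
      ((∫ u : ℝ, ‖h u‖ ^ 2 : ℝ) : ℂ) * ∑ n ∈ Finset.range (N + 1),
        ((weilSemilocalCoeff S n - weilSemilocalCoeff S' n : ℝ) : ℂ) *
          ∑ i ∈ s, ∑ j ∈ s, (if x i - x j = Real.log n then a i * conj (a j) + a j * conj (a i) else 0) := by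
  have hg := isWeilTest_comb hh s x a
  have hgs := tsupport_comb_subset (a := a) hsupp hx
  have hid := weilSemilocalQuadratic_sub_eq_sum hg hgs hN S S'
  rw [Finset.mul_sum]
  have hterm : ∀ n ∈ Finset.range (N + 1),
      ((weilSemilocalCoeff S n - weilSemilocalCoeff S' n : ℝ) : ℂ) *
          (weilConv (fun t ↦ ∑ i ∈ s, a i * h (t - x i)) (weilReflect fun t ↦ ∑ i ∈ s, a i * h (t - x i)) (Real.log n) +
            weilConv (fun t ↦ ∑ i ∈ s, a i * h (t - x i)) (weilReflect fun t ↦ ∑ i ∈ s, a i * h (t - x i)) (-Real.log n)) =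
        ((∫ u : ℝ, ‖h u‖ ^ 2 : ℝ) : ℂ) * (((weilSemilocalCoeff S n - weilSemilocalCoeff S' n : ℝ) : ℂ) *
          ∑ i ∈ s, ∑ j ∈ s, (if x i - x j = Real.log n then a i * conj (a j) + a j * conj (a i) else 0)) := by
    intro n hn
    by_cases h0 : weilSemilocalCoeff S n - weilSemilocalCoeff S' n = 0
    · rw [h0]; push_cast; ring
    · rw [weilConv_weilReflect_comb_add_neg hh hsupp fun i hi j hj ↦ hsep i hi j hj n hn h0]
      ring
  rw [← Finset.sum_congr rfl hterm]
  linear_combination (-1 : ℂ) * hid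

/-- Real part: `Re Q_{S'}(g) = Re Q_S(g) + ‖h‖₂² · Σ_n w_n Σ_{i,j : x_i − x_j = log n} 2 Re(a_i conj a_j)`. -/
theorem re_weilSemilocalQuadratic_comb (hh : IsWeilTest h) (hsupp : tsupport h ⊆ Icc (-δ) δ)
    (hx : ∀ i ∈ s, x i ∈ Icc (-(c - δ)) (c - δ)) (hN : 2 * c < Real.log ((N : ℝ) + 1)) (S S' : Finset ℕ)
    (hsep : ∀ i ∈ s, ∀ j ∈ s, ∀ n ∈ Finset.range (N + 1), weilSemilocalCoeff S n - weilSemilocalCoeff S' n ≠ 0 →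
      x i - x j = Real.log n ∨ 2 * δ < |x i - x j - Real.log n|) :
    (weilSemilocalQuadratic S' (fun t ↦ ∑ i ∈ s, a i * h (t - x i))).re =
      (weilSemilocalQuadratic S (fun t ↦ ∑ i ∈ s, a i * h (t - x i))).re +
        (∫ u : ℝ, ‖h u‖ ^ 2) * ∑ n ∈ Finset.range (N + 1), (weilSemilocalCoeff S n - weilSemilocalCoeff S' n) *
          ∑ i ∈ s, ∑ j ∈ s, (if x i - x j = Real.log n then (a i * conj (a j) + a j * conj (a i)).re else 0) := by
  have h := congrArg Complex.re (weilSemilocalQuadratic_sub_comb (a := a) hh hsupp hx hN S S' hsep)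
  rw [Complex.sub_re, Complex.re_ofReal_mul, Complex.re_sum] at h
  have e : ∀ n ∈ Finset.range (N + 1),
      (((weilSemilocalCoeff S n - weilSemilocalCoeff S' n : ℝ) : ℂ) *
          ∑ i ∈ s, ∑ j ∈ s, (if x i - x j = Real.log n then a i * conj (a j) + a j * conj (a i) else 0)).re =
        (weilSemilocalCoeff S n - weilSemilocalCoeff S' n) *
          ∑ i ∈ s, ∑ j ∈ s, (if x i - x j = Real.log n then (a i * conj (a j) + a j * conj (a i)).re else 0) := by
    intro n _
    rw [Complex.re_ofReal_mul, Complex.re_sum]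
    congr 1
    refine Finset.sum_congr rfl fun i _ ↦ ?_
    rw [Complex.re_sum]
    refine Finset.sum_congr rfl fun j _ ↦ ?_
    split_ifs <;> simp
  rw [Finset.sum_congr rfl e] at h
  linarith

/-! ## §3  Norm of the comb and the Rayleigh consequence -/

/-- **Norm of a separated comb**: if the positions are pairwise `2δ`-separated (`|x_i − x_j| > 2δ` for `i ≠ j`), then
`‖g‖₂² = ‖h‖₂² · Σ_i |a_i|²`. -/
theorem integral_norm_sq_comb (hh : IsWeilTest h) (hsupp : tsupport h ⊆ Icc (-δ) δ)
    (hdisj : ∀ i ∈ s, ∀ j ∈ s, i ≠ j → 2 * δ < |x i - x j|) :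
    ∫ u : ℝ, ‖∑ i ∈ s, a i * h (u - x i)‖ ^ 2 = (∫ u : ℝ, ‖h u‖ ^ 2) * ∑ i ∈ s, ‖a i‖ ^ 2 := by
  classical
  have h0 := weilConv_weilReflect_apply_zero (fun t ↦ ∑ i ∈ s, a i * h (t - x i))
  rw [weilConv_weilReflect_comb hh] at h0
  have e : ∑ i ∈ s, ∑ j ∈ s, a i * conj (a j) * weilConv h (weilReflect h) (0 + x j - x i) =
      ((∫ u : ℝ, ‖h u‖ ^ 2 : ℝ) : ℂ) * ∑ i ∈ s, ((‖a i‖ ^ 2 : ℝ) : ℂ) := by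
    rw [Finset.mul_sum]
    refine Finset.sum_congr rfl fun i hi ↦ ?_
    rw [Finset.sum_eq_single i]
    · rw [zero_add, sub_self, weilConv_weilReflect_apply_zero, Complex.mul_conj, Complex.normSq_eq_norm_sq]
      push_cast; ring
    · intro j hj hji
      have hfar := hdisj i hi j hj (Ne.symm hji)
      rw [weilConv_weilReflect_eq_zero_of_lt hh hsupp (t := 0 + x j - x i)
        (by rw [zero_add, ← abs_neg, neg_sub]; exact hfar), mul_zero]
    · intro hi'; exact absurd hi hi'
  rw [e] at h0
  have := congrArg Complex.re h0
  rw [Complex.ofReal_re] at this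
  rw [← this, Complex.re_ofReal_mul, Complex.re_sum]
  simp only [Complex.ofReal_re]

/-- **RAYLEIGH CONSEQUENCE (the configuration constant is attained up to the undeleted comb energy).**  Under the hypotheses of
`re_weilSemilocalQuadratic_comb` and pairwise `2δ`-separation of the positions:
`λ_min(S'; c)·‖h‖₂²·Σ_i|a_i|² ≤ Re Q_S(g) + ‖h‖₂²·Σ_n w_n Σ_{i,j : x_i − x_j = log n} 2Re(a_i conj a_j)` (unconstrained bottom). -/
theorem semilocalGroundEnergy_mul_le_comb (hh : IsWeilTest h) (hsupp : tsupport h ⊆ Icc (-δ) δ)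
    (hx : ∀ i ∈ s, x i ∈ Icc (-(c - δ)) (c - δ)) (hN : 2 * c < Real.log ((N : ℝ) + 1)) (S S' : Finset ℕ)
    (hsep : ∀ i ∈ s, ∀ j ∈ s, ∀ n ∈ Finset.range (N + 1), weilSemilocalCoeff S n - weilSemilocalCoeff S' n ≠ 0 →
      x i - x j = Real.log n ∨ 2 * δ < |x i - x j - Real.log n|)
    (hdisj : ∀ i ∈ s, ∀ j ∈ s, i ≠ j → 2 * δ < |x i - x j|) :
    semilocalGroundEnergy S' (fun _ ↦ True) c * ((∫ u : ℝ, ‖h u‖ ^ 2) * ∑ i ∈ s, ‖a i‖ ^ 2) ≤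
      (weilSemilocalQuadratic S (fun t ↦ ∑ i ∈ s, a i * h (t - x i))).re +
        (∫ u : ℝ, ‖h u‖ ^ 2) * ∑ n ∈ Finset.range (N + 1), (weilSemilocalCoeff S n - weilSemilocalCoeff S' n) *
          ∑ i ∈ s, ∑ j ∈ s, (if x i - x j = Real.log n then (a i * conj (a j) + a j * conj (a i)).re else 0) := by
  have hg := isWeilTest_comb hh s x a
  have hgs := tsupport_comb_subset (a := a) hsupp hx
  have h1 := semilocalGroundEnergy_mul_le_re (S := S') (P := fun _ ↦ True) hg hgs (fun _ _ ↦ trivial)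
  rw [integral_norm_sq_comb hh hsupp hdisj] at h1
  rw [← re_weilSemilocalQuadratic_comb (a := a) hh hsupp hx hN S S' hsep]
  exact h1

end Summit.RiemannHypothesis.RiemannHypothesis.Theorems.SemilocalDeletionAnimalCombs

end
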